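import Summits.QuantumFields.BalabanUV.Beta.GAN24.DerivativeRateTransferJensenMassFreeLatticeEnd
import Summits.QuantumFields.BalabanUV.Beta.GAN24.DerivativeRateTransferJensenMeanZeroTree

/-!
# `BalabanUV.Beta.GAN24.DerivativeRateTransferJensenMassFreePoincare` — binder row G-an2-4 ∕ (CONV-C), route R6 «VALUES, NOT DERIVATIVES», PART 64:
# THE BLOCK POINCARÉ DATUM FOR THE COMB TRANSPORTER AND THE LATTICE END WITH ONLY `p̂` LEFT — along the comb the transported displacement
# `W(y,z)u(z) − W(y,0)u(0)` is a sum of `Σ_ν z_ν ≤ d(L−1)` transported bond differences, so its square is `≤ (d(L−1))²·E_y(u)` with `E_y` the bond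
# energy of the block (crude count, no path bookkeeping); hence PART 47 ∕ 53's Poincaré letters `hP ∕ hΦ ∕ hΦ′` hold with `Φ(y) = 4(d(L−1))²E_y(u)` and
# `ϖ = ϖ′` any number with `w_c·4d³(L−1)² ≤ ϖ·w_f`; PART 63's END then has NO letter about the pair left except the plaquette letter `p̂` and the weights
# (unit b2b-balaban-gan24-p3, gen 44; v1)

NOT IN PRINT; OUR PROOF (for the ROUTE; [folklore] — a double induction over the comb of `Fin d → Fin L` (PART 59's pattern) with PART 25's square-root-free
triangle inequality, PART 49's «variance ≤ 4 × second moment», PART 24's counting, PART 63 BY NAME).  HONEST FRAMING (cell contract, verbatim): «discharging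
`BetaPertH` makes Bałaban's UV stability UNCONDITIONAL — a real constructive-QFT result; it is NOT the continuum limit and NOT the Clay problem.»  HONEST
DEPENDENCY (verbatim): «continuum YM on T⁴ ⇐ BetaPertH ∧ nine spine estimates (0/9 proved); BetaPertH ⇐ (D1) ∧ (D4) ∧ CAP+tail; G-an2-4 gates asym,
D1 and NE2/3/4.»

WHY THIS FILE.  PART 63 `covJensen_polar_lattice_of_plaquettes` leaves the block Poincaré data `Φ ∕ ϖ ∕ ϖ′` as hypotheses (PART 49's tree discharge is
stated for explicit root paths, not instantiated on PART 24's encoding).  For the COMB transporter the discharge needs no path bookkeeping: (§1)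
**`comb_displacement_sq_le`** — `|W(y,(y,z))u(y,z) − W(y,(y,0))u(y,0)|² ≤ (Σ_ν z_ν)²·E_y(u)`, `E_y(u) := Σ_{z′,μ}|R((y,z′),μ)u((y,z′) +_μ 1) − u(y,z′)|²`
(canonical-step induction: each step adds ONE transported bond difference of the block, `|a + b| ≤ |a| + |b|` square-root-free); (§2)
**`blockVar_comb_le`** — PART 47 ∕ 53's `hP` with `Φ(y) = 4(d(L−1))²·E_y(u)` (PART 49 `wvar_le_four_wmoment`, centre `W(y,0)u(y,0)`),
**`sum_blockEnergy_eq`** (`Σ_y E_y = Σ_e |D_eu|²`), **`combPoincare_budget_tgt ∕ _src`** — `hΦ ∕ hΦ′` with `ϖ = ϖ′` whenever `w_c·4d·(d(L−1))² ≤ ϖ·w_f`;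
(§3) **`covJensen_polar_lattice_of_plaquettes'`** — PART 63's END with the Poincaré letters DISCHARGED: from `R` (plaquettes within `p̂`), the comb
`W`, PART 24's chains, `2d(L−1)Lp̂ < 1`: ∃ orthogonal polar links `R′` such that for every `w_c ≥ 0` with `w_c·L·(L·(L^d)⁻¹) ≤ w_f`, every compatible
coarse form, every `ϖ ≥ 0` with `w_c·4d(d(L−1))² ≤ ϖ·w_f`, every `u` and all `t, r > 0`:
`⟨Qu, H_cQu⟩ ≤ (1 + t + (1+t⁻¹)(1+r)ϖ(2D)² + (1+t⁻¹)(1+r⁻¹)·3(2D)²(1 + 2ϖ)∕(4 − (2D)²))·⟨u, H_f u⟩`, `D = 2d(L−1)·L·p̂`.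

HONEST SCOPE.  The count is crude (`(d(L−1))²` per site instead of PART 49's `dep·(path share)`; a constant at fixed `d, L`); one axis order; `R′` in the
full orthogonal group of the colour fibre; `p̂` a letter; nothing of Bałaban's `G_k ∕ Δ_k ∕ Ū` instantiated; (STAB)^{cov} for the comb-averaged POLAR
pair on one scale — NOT the tower, NOT (CONS), NOT (CONV-C).

WHAT THIS FILE PROVES (0 sorry, 0 `def`, nothing cited): §1 `nxt_eq_update`, `bondEnergy_le_blockEnergy`, `comb_displacement_line`, **`comb_displacement_sq_le`**;
§2 **`blockVar_comb_le`**, `sum_blockEnergy_eq`, **`combPoincare_budget_tgt`**, **`combPoincare_budget_src`**; §3 **`covJensen_polar_lattice_of_plaquettes'`**.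
SUPPLIER work on route R6 (rank 2, REDUCTION, no seat); no consumer of record; NEVER «G-an2-4 closed»; NOT (CONV-C), NOT D1, NOT `BetaPertH`, NOT
continuum, NOT Clay.  Records: `HOME/b2b-balaban-gan24-p3/WOODBURY-FIBRE.md` v14.4. -/

noncomputable section

open Matrix Finset Function

namespace Summit.QuantumFields.BalabanUV.Beta.GAN24.DerivativeRateTransferJensenMassFreePoincare

open Summit.QuantumFields.BalabanUV.Beta.GAN24.DerivativeRateTransferJensenChain
open Summit.QuantumFields.BalabanUV.Beta.GAN24.DerivativeRateTransferJensenHolonomy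
open Summit.QuantumFields.BalabanUV.Beta.GAN24.DerivativeRateTransferJensenLattice
open Summit.QuantumFields.BalabanUV.Beta.GAN24.DerivativeRateTransferJensenMeanZeroTree
open Summit.QuantumFields.BalabanUV.Beta.GAN24.DerivativeRateTransferJensenMassFreeHub
open Summit.QuantumFields.BalabanUV.Beta.GAN24.DerivativeRateTransferJensenMassFreeRectangle
open Summit.QuantumFields.BalabanUV.Beta.GAN24.DerivativeRateTransferJensenMassFreeLatticeEnd

variable {d L M : ℕ} {o : Type*} [Fintype o] [DecidableEq o]

/-! ## §1 The transported displacement along the comb -/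

section Displacement

omit [Fintype o] [DecidableEq o] in
/-- the next site in direction `μ` inside the block: no carry when `z_μ + 1 < L`. [folklore] -/
theorem nxt_eq_update (hL : 0 < L) (y : Fin d → ZMod M) (z : Fin d → Fin L) (μ : Fin d) (h : (z μ : ℕ) + 1 < L) :
    ((y + (((z μ : ℕ) + 1) / L) • (Pi.single μ (1 : ZMod M)), update z μ ⟨((z μ : ℕ) + 1) % L, Nat.mod_lt _ hL⟩) :
        (Fin d → ZMod M) × (Fin d → Fin L)) = (y, update z μ ⟨(z μ : ℕ) + 1, h⟩) := by
  simp only [Prod.mk.injEq]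
  refine ⟨?_, ?_⟩
  · rw [(nxt_of_lt h).1, zero_smul, add_zero]
  · exact congrArg (update z μ) (Fin.ext (nxt_of_lt h).2)

omit [DecidableEq o] in
/-- one bond energy is at most the block energy (a sum of nonnegatives). [folklore] -/
theorem bondEnergy_le_blockEnergy (F : ((Fin d → ZMod M) × (Fin d → Fin L)) × Fin d → ℝ) (hF : ∀ e, 0 ≤ F e) (y : Fin d → ZMod M)
    (z : Fin d → Fin L) (μ : Fin d) : F ((y, z), μ) ≤ ∑ z' : Fin d → Fin L, ∑ ν : Fin d, F ((y, z'), ν) := by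
  have h1 : F ((y, z), μ) ≤ ∑ ν : Fin d, F ((y, z), ν) :=
    Finset.single_le_sum (f := fun ν => F ((y, z), ν)) (fun ν _ => hF _) (Finset.mem_univ μ)
  exact h1.trans (Finset.single_le_sum (f := fun z' : Fin d → Fin L => ∑ ν : Fin d, F ((y, z'), ν))
    (fun z' _ => Finset.sum_nonneg fun ν _ => hF _) (Finset.mem_univ z))

/-- **the inner induction along one direction**: from a displacement bound `B₀²·E` at `z⁰` (`z⁰_μ = 0`, later coordinates zero) to
`(B₀ + j)²·E` at `update z⁰ μ j`, one transported bond difference per canonical step (bond differences bounded by a bond datum `F ≤ E`). [our proof] -/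
theorem comb_displacement_line
    {R : ((Fin d → ZMod M) × (Fin d → Fin L)) × Fin d → Matrix o o ℝ}
    {W : (Fin d → ZMod M) → (Fin d → ZMod M) × (Fin d → Fin L) → Matrix o o ℝ} (hW : ∀ y x, (W y x)ᵀ * W y x = 1)
    (hWstep : ∀ (y : Fin d → ZMod M) (z : Fin d → Fin L) (μ : Fin d) (h : (z μ : ℕ) + 1 < L), (∀ ν, μ < ν → (z ν : ℕ) = 0) →
      W y (y, update z μ ⟨(z μ : ℕ) + 1, h⟩) = W y (y, z) * R ((y, z), μ))
    (y : Fin d → ZMod M) (u : ((Fin d → ZMod M) × (Fin d → Fin L)) × o → ℝ) {F : ((Fin d → ZMod M) × (Fin d → Fin L)) × Fin d → ℝ}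
    (hF : ∀ (z : Fin d → Fin L) (μ : Fin d) (h : (z μ : ℕ) + 1 < L),
      ((R ((y, z), μ) *ᵥ fun b => u ((y, update z μ ⟨(z μ : ℕ) + 1, h⟩), b)) - fun b => u ((y, z), b)) ⬝ᵥ
        ((R ((y, z), μ) *ᵥ fun b => u ((y, update z μ ⟨(z μ : ℕ) + 1, h⟩), b)) - fun b => u ((y, z), b)) ≤ F ((y, z), μ))
    {E : ℝ} (hE0 : 0 ≤ E) (hE : ∀ (z : Fin d → Fin L) (μ : Fin d), F ((y, z), μ) ≤ E)
    (c : o → ℝ) (z0 : Fin d → Fin L) (μ : Fin d) (hz0μ : (z0 μ : ℕ) = 0) (hz0 : ∀ ν, μ < ν → (z0 ν : ℕ) = 0) {B₀ : ℝ} (hB₀ : 0 ≤ B₀)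
    (hc : ((W y (y, z0) *ᵥ fun b => u ((y, z0), b)) - c) ⬝ᵥ ((W y (y, z0) *ᵥ fun b => u ((y, z0), b)) - c) ≤ B₀ ^ 2 * E) :
    ∀ (j : ℕ) (hj : j < L),
      ((W y (y, update z0 μ ⟨j, hj⟩) *ᵥ fun b => u ((y, update z0 μ ⟨j, hj⟩), b)) - c) ⬝ᵥ
          ((W y (y, update z0 μ ⟨j, hj⟩) *ᵥ fun b => u ((y, update z0 μ ⟨j, hj⟩), b)) - c) ≤ (B₀ + j) ^ 2 * E := by
  intro j
  induction j with
  | zero =>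
    intro hj
    have e : update z0 μ (⟨0, hj⟩ : Fin L) = z0 := by
      rw [update_eq_self_iff]; exact Fin.ext hz0μ.symm
    rw [e, Nat.cast_zero, add_zero]
    exact hc
  | succ j ih =>
    intro hj
    have hj' : j < L := Nat.lt_of_succ_lt hj
    have hlater : ∀ ν, μ < ν → ((update z0 μ (⟨j, hj'⟩ : Fin L) ν : Fin L) : ℕ) = 0 := fun ν hν => by
      rw [update_of_ne (ne_of_gt hν)]; exact hz0 ν hν
    have hval : ((update z0 μ (⟨j, hj'⟩ : Fin L) μ : Fin L) : ℕ) + 1 < L := by rw [update_self]; exact hj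
    have ezj1 : update (update z0 μ (⟨j, hj'⟩ : Fin L)) μ ⟨((update z0 μ (⟨j, hj'⟩ : Fin L) μ : Fin L) : ℕ) + 1, hval⟩ =
        update z0 μ (⟨j + 1, hj⟩ : Fin L) := by
      rw [update_idem]
      congr 1
      exact Fin.ext (by simp only [update_self])
    -- the one-step displacement is a transported bond difference
    have hWs := hWstep y (update z0 μ ⟨j, hj'⟩) μ hval hlater
    have hFj := (hF (update z0 μ ⟨j, hj'⟩) μ hval).trans (hE (update z0 μ ⟨j, hj'⟩) μ)
    rw [ezj1] at hWs hFj
    have ea : (W y (y, update z0 μ ⟨j + 1, hj⟩) *ᵥ fun b => u ((y, update z0 μ ⟨j + 1, hj⟩), b)) - c =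
        W y (y, update z0 μ ⟨j, hj'⟩) *ᵥ ((R ((y, update z0 μ ⟨j, hj'⟩), μ) *ᵥ fun b => u ((y, update z0 μ ⟨j + 1, hj⟩), b)) -
            fun b => u ((y, update z0 μ ⟨j, hj'⟩), b)) +
          ((W y (y, update z0 μ ⟨j, hj'⟩) *ᵥ fun b => u ((y, update z0 μ ⟨j, hj'⟩), b)) - c) := by
      rw [hWs, ← mulVec_mulVec, mulVec_sub]; abel
    rw [ea]
    have ha : (W y (y, update z0 μ ⟨j, hj'⟩) *ᵥ ((R ((y, update z0 μ ⟨j, hj'⟩), μ) *ᵥ fun b => u ((y, update z0 μ ⟨j + 1, hj⟩), b)) -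
            fun b => u ((y, update z0 μ ⟨j, hj'⟩), b))) ⬝ᵥ
        (W y (y, update z0 μ ⟨j, hj'⟩) *ᵥ ((R ((y, update z0 μ ⟨j, hj'⟩), μ) *ᵥ fun b => u ((y, update z0 μ ⟨j + 1, hj⟩), b)) -
            fun b => u ((y, update z0 μ ⟨j, hj'⟩), b))) ≤ 1 ^ 2 * E := by
      rw [self_of_orthogonal (hW _ _), one_pow, one_mul]
      exact hFj
    have h := dotProduct_self_add_le_sq _ _ zero_le_one (by positivity : (0 : ℝ) ≤ B₀ + j) hE0 ha (ih hj')
    refine h.trans (le_of_eq ?_)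
    push_cast; ring

/-- **`comb_displacement_sq_le` — THE TRANSPORTED DISPLACEMENT ALONG THE COMB** [our proof]: orthogonal `W` with the comb recursion, a nonnegative bond
datum `F` dominating the in-block bond differences `|R((y,z),μ)u(y,z+e_μ) − u(y,z)|²` ⟹ for every position `z`:
`|W(y,(y,z))u(y,z) − W(y,(y,0))u(y,0)|² ≤ (Σ_ν z_ν)²·Σ_{z′,μ} F((y,z′),μ)`. -/
theorem comb_displacement_sq_le (hL : 0 < L)
    {R : ((Fin d → ZMod M) × (Fin d → Fin L)) × Fin d → Matrix o o ℝ}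
    {W : (Fin d → ZMod M) → (Fin d → ZMod M) × (Fin d → Fin L) → Matrix o o ℝ} (hW : ∀ y x, (W y x)ᵀ * W y x = 1)
    (hWstep : ∀ (y : Fin d → ZMod M) (z : Fin d → Fin L) (μ : Fin d) (h : (z μ : ℕ) + 1 < L), (∀ ν, μ < ν → (z ν : ℕ) = 0) →
      W y (y, update z μ ⟨(z μ : ℕ) + 1, h⟩) = W y (y, z) * R ((y, z), μ))
    (y : Fin d → ZMod M) (u : ((Fin d → ZMod M) × (Fin d → Fin L)) × o → ℝ) {F : ((Fin d → ZMod M) × (Fin d → Fin L)) × Fin d → ℝ}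
    (hF0 : ∀ e, 0 ≤ F e)
    (hF : ∀ (z : Fin d → Fin L) (μ : Fin d) (h : (z μ : ℕ) + 1 < L),
      ((R ((y, z), μ) *ᵥ fun b => u ((y, update z μ ⟨(z μ : ℕ) + 1, h⟩), b)) - fun b => u ((y, z), b)) ⬝ᵥ
        ((R ((y, z), μ) *ᵥ fun b => u ((y, update z μ ⟨(z μ : ℕ) + 1, h⟩), b)) - fun b => u ((y, z), b)) ≤ F ((y, z), μ))
    (z : Fin d → Fin L) :
    ((W y (y, z) *ᵥ fun b => u ((y, z), b)) - W y (y, fun _ => ⟨0, hL⟩) *ᵥ fun b => u ((y, fun _ => ⟨0, hL⟩), b)) ⬝ᵥ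
        ((W y (y, z) *ᵥ fun b => u ((y, z), b)) - W y (y, fun _ => ⟨0, hL⟩) *ᵥ fun b => u ((y, fun _ => ⟨0, hL⟩), b)) ≤
      ((∑ ν, (z ν : ℕ) : ℕ) : ℝ) ^ 2 * ∑ z' : Fin d → Fin L, ∑ μ : Fin d, F ((y, z'), μ) := by
  set E : ℝ := ∑ z' : Fin d → Fin L, ∑ μ : Fin d, F ((y, z'), μ) with hEdef
  have hE0 : 0 ≤ E := Finset.sum_nonneg fun z' _ => Finset.sum_nonneg fun μ _ => hF0 _
  have hE : ∀ (z : Fin d → Fin L) (μ : Fin d), F ((y, z), μ) ≤ E := fun z μ => bondEnergy_le_blockEnergy F hF0 y z μ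
  set c : o → ℝ := W y (y, fun _ => ⟨0, hL⟩) *ᵥ fun b => u ((y, fun _ => ⟨0, hL⟩), b) with hc
  -- outer induction on the number of directions in use
  suffices H : ∀ k : ℕ, k ≤ d → ∀ z : Fin d → Fin L, (∀ ν : Fin d, k ≤ (ν : ℕ) → (z ν : ℕ) = 0) →
      ((W y (y, z) *ᵥ fun b => u ((y, z), b)) - c) ⬝ᵥ ((W y (y, z) *ᵥ fun b => u ((y, z), b)) - c) ≤ ((∑ ν, (z ν : ℕ) : ℕ) : ℝ) ^ 2 * E from
    H d le_rfl z (fun ν hν => absurd ν.isLt (not_lt.mpr hν))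
  intro k
  induction k with
  | zero =>
    intro _ z hz
    have e : z = fun _ => ⟨0, hL⟩ := funext fun ν => Fin.ext (hz ν (Nat.zero_le _))
    subst e
    rw [hc, sub_self, dotProduct_zero]
    exact mul_nonneg (sq_nonneg _) hE0
  | succ k ih =>
    intro hk z hz
    have hkd : k < d := Nat.lt_of_succ_le hk
    set μ : Fin d := ⟨k, hkd⟩ with hμ
    set z0 : Fin d → Fin L := update z μ ⟨0, hL⟩ with hz0def
    have hz0 : ∀ ν : Fin d, k ≤ (ν : ℕ) → (z0 ν : ℕ) = 0 := fun ν hν => by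
      by_cases hνμ : ν = μ
      · rw [hνμ, hz0def, update_self]
      · rw [hz0def, update_of_ne hνμ]
        refine hz ν (Nat.succ_le_of_lt (lt_of_le_of_ne hν fun h => hνμ (Fin.ext ?_)))
        rw [hμ]; exact h.symm
    have hB₀ := ih hkd.le z0 hz0
    have hz0μ : (z0 μ : ℕ) = 0 := by rw [hz0def, update_self]
    have hz0later : ∀ ν, μ < ν → (z0 ν : ℕ) = 0 := fun ν hν => hz0 ν (Nat.le_of_lt (Fin.lt_def.mp hν))
    have hline := comb_displacement_line hW hWstep y u hF hE0 hE c z0 μ hz0μ hz0later (by positivity) hB₀ (z μ : ℕ) (z μ).isLt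
    have e : update z0 μ (⟨(z μ : ℕ), (z μ).isLt⟩ : Fin L) = z := by
      rw [hz0def, update_idem, update_eq_self_iff]
    rw [e] at hline
    refine hline.trans (le_of_eq ?_)
    have hsum : ((∑ ν, (z0 ν : ℕ) : ℕ) : ℝ) + (z μ : ℕ) = ((∑ ν, (z ν : ℕ) : ℕ) : ℝ) := by
      have h := sum_val_update z μ (⟨0, hL⟩ : Fin L)
      rw [← hz0def] at h
      simp only [add_zero] at h
      exact_mod_cast h
    rw [← hsum]

end Displacement

/-! ## §2 The block Poincaré datum and its budgets -/

section Poincare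

variable [NeZero M]

/-- **`blockVar_comb_le` — PART 47 ∕ 53's `hP` FOR THE COMB TRANSPORTER** [our proof]: with the block weights and the averaging identity of PART 24's
encoding, `Σ_x q(y,x)|W(y,x)u(x) − (Qu)(y)|² ≤ 4(d(L−1))²·Σ_{z′,μ}F((y,z′),μ)` (PART 49 `wvar_le_four_wmoment` with centre `W(y,0)u(y,0)` + §1). -/
theorem blockVar_comb_le (hL : 0 < L)
    {R : ((Fin d → ZMod M) × (Fin d → Fin L)) × Fin d → Matrix o o ℝ}
    {W : (Fin d → ZMod M) → (Fin d → ZMod M) × (Fin d → Fin L) → Matrix o o ℝ} (hW : ∀ y x, (W y x)ᵀ * W y x = 1)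
    (hWstep : ∀ (y : Fin d → ZMod M) (z : Fin d → Fin L) (μ : Fin d) (h : (z μ : ℕ) + 1 < L), (∀ ν, μ < ν → (z ν : ℕ) = 0) →
      W y (y, update z μ ⟨(z μ : ℕ) + 1, h⟩) = W y (y, z) * R ((y, z), μ))
    {Q : Matrix ((Fin d → ZMod M) × o) (((Fin d → ZMod M) × (Fin d → Fin L)) × o) ℝ}
    (hQ : ∀ (u : ((Fin d → ZMod M) × (Fin d → Fin L)) × o → ℝ) (y : Fin d → ZMod M),
      (fun a => (Q *ᵥ u) (y, a)) = ∑ x, (if x.1 = y then ((L : ℝ) ^ d)⁻¹ else 0) • (W y x *ᵥ fun b => u (x, b)))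
    (u : ((Fin d → ZMod M) × (Fin d → Fin L)) × o → ℝ) {F : ((Fin d → ZMod M) × (Fin d → Fin L)) × Fin d → ℝ} (hF0 : ∀ e, 0 ≤ F e)
    (hF : ∀ (y : Fin d → ZMod M) (z : Fin d → Fin L) (μ : Fin d) (h : (z μ : ℕ) + 1 < L),
      ((R ((y, z), μ) *ᵥ fun b => u ((y, update z μ ⟨(z μ : ℕ) + 1, h⟩), b)) - fun b => u ((y, z), b)) ⬝ᵥ
        ((R ((y, z), μ) *ᵥ fun b => u ((y, update z μ ⟨(z μ : ℕ) + 1, h⟩), b)) - fun b => u ((y, z), b)) ≤ F ((y, z), μ))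
    (y : Fin d → ZMod M) :
    ∑ x, (if x.1 = y then ((L : ℝ) ^ d)⁻¹ else 0) * (((W y x *ᵥ fun b => u (x, b)) - fun a => (Q *ᵥ u) (y, a)) ⬝ᵥ
        ((W y x *ᵥ fun b => u (x, b)) - fun a => (Q *ᵥ u) (y, a))) ≤
      4 * (d * ((L : ℝ) - 1)) ^ 2 * ∑ z' : Fin d → Fin L, ∑ μ : Fin d, F ((y, z'), μ) := by
  haveI : NeZero L := ⟨hL.ne'⟩
  set E : ℝ := ∑ z' : Fin d → Fin L, ∑ μ : Fin d, F ((y, z'), μ) with hEdef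
  have hE0 : 0 ≤ E := Finset.sum_nonneg fun z' _ => Finset.sum_nonneg fun μ _ => hF0 _
  set c : o → ℝ := W y (y, fun _ => ⟨0, hL⟩) *ᵥ fun b => u ((y, fun _ => ⟨0, hL⟩), b) with hc
  rw [hQ u y]
  have h1 := wvar_le_four_wmoment Finset.univ (fun x _ => blockWeight_nonneg y x) (sum_blockWeight y)
    (fun x : (Fin d → ZMod M) × (Fin d → Fin L) => W y x *ᵥ fun b => u (x, b)) c
  refine h1.trans ?_
  have key : ∀ x : (Fin d → ZMod M) × (Fin d → Fin L),
      (if x.1 = y then ((L : ℝ) ^ d)⁻¹ else 0) * (((W y x *ᵥ fun b => u (x, b)) - c) ⬝ᵥ ((W y x *ᵥ fun b => u (x, b)) - c)) ≤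
        (if x.1 = y then ((L : ℝ) ^ d)⁻¹ else 0) * ((d * ((L : ℝ) - 1)) ^ 2 * E) := fun x => by
    by_cases hx : x.1 = y
    · refine mul_le_mul_of_nonneg_left ?_ (blockWeight_nonneg y x)
      obtain ⟨x1, x2⟩ := x
      simp only at hx
      subst hx
      refine (comb_displacement_sq_le hL hW hWstep x1 u hF0 (hF x1) x2).trans ?_
      exact mul_le_mul_of_nonneg_right (pow_le_pow_left₀ (Nat.cast_nonneg _) (sum_val_le x2) 2) hE0
    · simp only [if_neg hx, zero_mul, le_refl]
  calc 4 * ∑ x, (if x.1 = y then ((L : ℝ) ^ d)⁻¹ else 0) * (((W y x *ᵥ fun b => u (x, b)) - c) ⬝ᵥ ((W y x *ᵥ fun b => u (x, b)) - c))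
      ≤ 4 * ∑ x : (Fin d → ZMod M) × (Fin d → Fin L), (if x.1 = y then ((L : ℝ) ^ d)⁻¹ else 0) * ((d * ((L : ℝ) - 1)) ^ 2 * E) :=
        mul_le_mul_of_nonneg_left (Finset.sum_le_sum fun x _ => key x) (by norm_num)
    _ = 4 * (d * ((L : ℝ) - 1)) ^ 2 * E := by rw [← Finset.sum_mul, sum_blockWeight y]; ring

omit [Fintype o] [DecidableEq o] in
/-- `Σ_y Σ_{z,μ} F((y,z),μ) = Σ_e F(e)`. [folklore] -/
theorem sum_blockEnergy_eq (F : ((Fin d → ZMod M) × (Fin d → Fin L)) × Fin d → ℝ) :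
    ∑ y : Fin d → ZMod M, ∑ z : Fin d → Fin L, ∑ μ : Fin d, F ((y, z), μ) = ∑ e, F e := by
  rw [Fintype.sum_prod_type, Fintype.sum_prod_type]

omit [Fintype o] [DecidableEq o] in
/-- **`combPoincare_budget_tgt` — PART 47 ∕ 53's `hΦ`** [our proof]: with `Φ(y) = 4(d(L−1))²·Σ_{z,μ}F((y,z),μ)`, a fine form `H_f ≥ w_f·Σ_eF(e)` and
`w_c·4d(d(L−1))² ≤ ϖ·w_f`, `ϖ ≥ 0`: `w_c·Σ_{(y,μ′)}Φ(y + e_{μ′}) ≤ ϖ·⟨u, H_f u⟩`. -/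
theorem combPoincare_budget_tgt {F : ((Fin d → ZMod M) × (Fin d → Fin L)) × Fin d → ℝ} (hF0 : ∀ e, 0 ≤ F e) {wc wf ϖ H : ℝ}
    (hHf : wf * ∑ e, F e ≤ H) (hϖ : wc * (4 * d * (d * ((L : ℝ) - 1)) ^ 2) ≤ ϖ * wf) (hϖ0 : 0 ≤ ϖ) :
    wc * ∑ e' : (Fin d → ZMod M) × Fin d, 4 * (d * ((L : ℝ) - 1)) ^ 2 * ∑ z : Fin d → Fin L, ∑ μ : Fin d, F ((e'.1 + Pi.single e'.2 1, z), μ) ≤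
      ϖ * H := by
  have hre : ∑ e' : (Fin d → ZMod M) × Fin d, 4 * (d * ((L : ℝ) - 1)) ^ 2 * ∑ z : Fin d → Fin L, ∑ μ : Fin d, F ((e'.1 + Pi.single e'.2 1, z), μ) =
      4 * d * (d * ((L : ℝ) - 1)) ^ 2 * ∑ e, F e := by
    rw [Fintype.sum_prod_type, Finset.sum_comm]
    have h : ∀ μ' : Fin d, ∑ y : Fin d → ZMod M, 4 * (d * ((L : ℝ) - 1)) ^ 2 * ∑ z : Fin d → Fin L, ∑ μ : Fin d, F ((y + Pi.single μ' 1, z), μ) =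
        4 * (d * ((L : ℝ) - 1)) ^ 2 * ∑ e, F e := fun μ' => by
      have hc := Equiv.sum_comp (Equiv.addRight (Pi.single μ' (1 : ZMod M)))
        (fun y : Fin d → ZMod M => ∑ z : Fin d → Fin L, ∑ μ : Fin d, F ((y, z), μ))
      simp only [Equiv.coe_addRight] at hc
      rw [← Finset.mul_sum, hc, sum_blockEnergy_eq]
    simp only [h, Finset.sum_const, Finset.card_univ, Fintype.card_fin, nsmul_eq_mul]
    ring
  rw [hre]
  have hS : 0 ≤ ∑ e, F e := Finset.sum_nonneg fun e _ => hF0 e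
  calc wc * (4 * d * (d * ((L : ℝ) - 1)) ^ 2 * ∑ e, F e) = (wc * (4 * d * (d * ((L : ℝ) - 1)) ^ 2)) * ∑ e, F e := by ring
    _ ≤ (ϖ * wf) * ∑ e, F e := mul_le_mul_of_nonneg_right hϖ hS
    _ = ϖ * (wf * ∑ e, F e) := by ring
    _ ≤ ϖ * H := mul_le_mul_of_nonneg_left hHf hϖ0

omit [Fintype o] [DecidableEq o] in
/-- **`combPoincare_budget_src` — PART 53's `hΦ′`** [our proof]: same, at the sources: `w_c·Σ_{(y,μ′)}Φ(y) ≤ ϖ·⟨u, H_f u⟩`. -/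
theorem combPoincare_budget_src {F : ((Fin d → ZMod M) × (Fin d → Fin L)) × Fin d → ℝ} (hF0 : ∀ e, 0 ≤ F e) {wc wf ϖ H : ℝ}
    (hHf : wf * ∑ e, F e ≤ H) (hϖ : wc * (4 * d * (d * ((L : ℝ) - 1)) ^ 2) ≤ ϖ * wf) (hϖ0 : 0 ≤ ϖ) :
    wc * ∑ e' : (Fin d → ZMod M) × Fin d, 4 * (d * ((L : ℝ) - 1)) ^ 2 * ∑ z : Fin d → Fin L, ∑ μ : Fin d, F ((e'.1, z), μ) ≤ ϖ * H := by
  have hre : ∑ e' : (Fin d → ZMod M) × Fin d, 4 * (d * ((L : ℝ) - 1)) ^ 2 * ∑ z : Fin d → Fin L, ∑ μ : Fin d, F ((e'.1, z), μ) =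
      4 * d * (d * ((L : ℝ) - 1)) ^ 2 * ∑ e, F e := by
    rw [Fintype.sum_prod_type]
    simp only [Finset.sum_const, Finset.card_univ, Fintype.card_fin, nsmul_eq_mul]
    rw [← sum_blockEnergy_eq F, Finset.mul_sum]
    exact Finset.sum_congr rfl fun y _ => by ring
  rw [hre]
  have hS : 0 ≤ ∑ e, F e := Finset.sum_nonneg fun e _ => hF0 e
  calc wc * (4 * d * (d * ((L : ℝ) - 1)) ^ 2 * ∑ e, F e) = (wc * (4 * d * (d * ((L : ℝ) - 1)) ^ 2)) * ∑ e, F e := by ring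
    _ ≤ (ϖ * wf) * ∑ e, F e := mul_le_mul_of_nonneg_right hϖ hS
    _ = ϖ * (wf * ∑ e, F e) := by ring
    _ ≤ ϖ * H := mul_le_mul_of_nonneg_left hHf hϖ0

end Poincare

/-! ## §3 PART 63's END with the Poincaré letters discharged -/

section End

variable [NeZero M]

/-- **`covJensen_polar_lattice_of_plaquettes'` — THE POLAR PAIR's (STAB)^{cov} ON THE BLOCK LATTICE FROM THE PLAQUETTE LETTER ALONE** [our proof;
PART 63 + §2].  PART 63's data (`R` with plaquettes within `p̂`, comb `W`, averaging `Q`, fine form `H_f ≥ w_f·Σ|D_eu|²`, PART 24's chains `T`,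
`2d(L−1)Lp̂ < 1`) ⟹ ∃ orthogonal polar links `R′` such that for every `w_c ≥ 0` with `w_c·L·(L·(L^d)⁻¹) ≤ w_f`, every
`H_c ≤ w_c·Σ|R′v(y+e_{μ′}) − v(y)|²`, every `ϖ ≥ 0` with `w_c·4d(d(L−1))² ≤ ϖ·w_f`, every `u` and all `t, r > 0`:
`⟨Qu, H_cQu⟩ ≤ (1 + t + (1+t⁻¹)(1+r)ϖ(2D)² + (1+t⁻¹)(1+r⁻¹)·3(2D)²(1 + ϖ + ϖ)∕(4 − (2D)²))·⟨u, H_f u⟩`, `D = 2d(L−1)·L·p̂`. -/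
theorem covJensen_polar_lattice_of_plaquettes' (hL : 0 < L)
    {R : ((Fin d → ZMod M) × (Fin d → Fin L)) × Fin d → Matrix o o ℝ} (hR : ∀ e, (R e)ᵀ * R e = 1) {phat : ℝ} (hphat : 0 ≤ phat)
    (hplaq : ∀ (p : (Fin d → ZMod M) × (Fin d → Fin L)) (μ' μ : Fin d), μ' ≠ μ → ∀ w : o → ℝ,
      ((R (p, μ') *
              R (((p.1 + (((p.2 μ' : ℕ) + 1) / L) • (Pi.single μ' (1 : ZMod M)), update p.2 μ' ⟨((p.2 μ' : ℕ) + 1) % L, Nat.mod_lt _ hL⟩) :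
                (Fin d → ZMod M) × (Fin d → Fin L)), μ) *
            (R (((p.1 + (((p.2 μ : ℕ) + 1) / L) • (Pi.single μ (1 : ZMod M)), update p.2 μ ⟨((p.2 μ : ℕ) + 1) % L, Nat.mod_lt _ hL⟩) :
                (Fin d → ZMod M) × (Fin d → Fin L)), μ'))ᵀ *
          (R (p, μ))ᵀ - 1) *ᵥ w) ⬝ᵥ
        ((R (p, μ') *
              R (((p.1 + (((p.2 μ' : ℕ) + 1) / L) • (Pi.single μ' (1 : ZMod M)), update p.2 μ' ⟨((p.2 μ' : ℕ) + 1) % L, Nat.mod_lt _ hL⟩) :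
                (Fin d → ZMod M) × (Fin d → Fin L)), μ) *
            (R (((p.1 + (((p.2 μ : ℕ) + 1) / L) • (Pi.single μ (1 : ZMod M)), update p.2 μ ⟨((p.2 μ : ℕ) + 1) % L, Nat.mod_lt _ hL⟩) :
                (Fin d → ZMod M) × (Fin d → Fin L)), μ'))ᵀ *
          (R (p, μ))ᵀ - 1) *ᵥ w) ≤ phat ^ 2 * (w ⬝ᵥ w))
    {W : (Fin d → ZMod M) → (Fin d → ZMod M) × (Fin d → Fin L) → Matrix o o ℝ} (hW : ∀ y x, (W y x)ᵀ * W y x = 1)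
    (hWstep : ∀ (y : Fin d → ZMod M) (z : Fin d → Fin L) (μ : Fin d) (h : (z μ : ℕ) + 1 < L), (∀ ν, μ < ν → (z ν : ℕ) = 0) →
      W y (y, update z μ ⟨(z μ : ℕ) + 1, h⟩) = W y (y, z) * R ((y, z), μ))
    {Q : Matrix ((Fin d → ZMod M) × o) (((Fin d → ZMod M) × (Fin d → Fin L)) × o) ℝ}
    (hQ : ∀ (u : ((Fin d → ZMod M) × (Fin d → Fin L)) × o → ℝ) (y : Fin d → ZMod M),
      (fun a => (Q *ᵥ u) (y, a)) = ∑ x, (if x.1 = y then ((L : ℝ) ^ d)⁻¹ else 0) • (W y x *ᵥ fun b => u (x, b)))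
    {Hf : Matrix (((Fin d → ZMod M) × (Fin d → Fin L)) × o) (((Fin d → ZMod M) × (Fin d → Fin L)) × o) ℝ} {wf : ℝ}
    (hHf : ∀ u : ((Fin d → ZMod M) × (Fin d → Fin L)) × o → ℝ,
      wf * ∑ e : ((Fin d → ZMod M) × (Fin d → Fin L)) × Fin d,
        ((R e *ᵥ fun b => u ((e.1.1 + ((((e.1.2 e.2 : ℕ) + 1) / L) • (Pi.single e.2 (1 : ZMod M))),
            update e.1.2 e.2 ⟨((e.1.2 e.2 : ℕ) + 1) % L, Nat.mod_lt _ hL⟩), b)) - fun b => u (e.1, b)) ⬝ᵥ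
          ((R e *ᵥ fun b => u ((e.1.1 + ((((e.1.2 e.2 : ℕ) + 1) / L) • (Pi.single e.2 (1 : ZMod M))),
            update e.1.2 e.2 ⟨((e.1.2 e.2 : ℕ) + 1) % L, Nat.mod_lt _ hL⟩), b)) - fun b => u (e.1, b)) ≤ u ⬝ᵥ (Hf *ᵥ u))
    {T : (Fin d → ZMod M) × Fin d → (Fin d → ZMod M) × (Fin d → Fin L) → ℕ → Matrix o o ℝ} (hT0 : ∀ e' x, T e' x 0 = 1)
    (hT : ∀ e' x i, i < L → T e' x (i + 1) = T e' x i *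
      R (((x.1 + (((x.2 e'.2 : ℕ) + i) / L) • (Pi.single e'.2 (1 : ZMod M)),
            update x.2 e'.2 ⟨((x.2 e'.2 : ℕ) + i) % L, Nat.mod_lt _ hL⟩) : (Fin d → ZMod M) × (Fin d → Fin L)), e'.2))
    (hsmall : 2 * (d * ((L : ℝ) - 1)) * (L * phat) < 1) :
    ∃ R' : (Fin d → ZMod M) × Fin d → Matrix o o ℝ, (∀ e', (R' e')ᵀ * R' e' = 1) ∧
      ∀ (wc : ℝ) (_hwc : 0 ≤ wc) (_hw : wc * L * (L * ((L : ℝ) ^ d)⁻¹) ≤ wf) (Hc : Matrix ((Fin d → ZMod M) × o) ((Fin d → ZMod M) × o) ℝ)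
        (_hHc : ∀ v : (Fin d → ZMod M) × o → ℝ, v ⬝ᵥ (Hc *ᵥ v) ≤
          wc * ∑ e' : (Fin d → ZMod M) × Fin d, ((R' e' *ᵥ fun a => v (e'.1 + Pi.single e'.2 1, a)) - fun a => v (e'.1, a)) ⬝ᵥ
            ((R' e' *ᵥ fun a => v (e'.1 + Pi.single e'.2 1, a)) - fun a => v (e'.1, a)))
        (ϖ : ℝ) (_hϖ0 : 0 ≤ ϖ) (_hϖ : wc * (4 * d * (d * ((L : ℝ) - 1)) ^ 2) ≤ ϖ * wf)
        (u : ((Fin d → ZMod M) × (Fin d → Fin L)) × o → ℝ) (t r : ℝ) (_ht : 0 < t) (_hr : 0 < r),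
        (Q *ᵥ u) ⬝ᵥ (Hc *ᵥ (Q *ᵥ u)) ≤
          (1 + t + (1 + t⁻¹) * (1 + r) * ϖ * (2 * (2 * (d * ((L : ℝ) - 1)) * (L * phat))) ^ 2 +
              (1 + t⁻¹) * (1 + r⁻¹) * (3 * (2 * (2 * (d * ((L : ℝ) - 1)) * (L * phat))) ^ 2 /
                (4 - (2 * (2 * (d * ((L : ℝ) - 1)) * (L * phat))) ^ 2)) * (1 + ϖ + ϖ)) * (u ⬝ᵥ (Hf *ᵥ u)) := by
  obtain ⟨R', h1, h2⟩ := covJensen_polar_lattice_of_plaquettes hL hR hphat hplaq hW hWstep hQ hHf hT0 hT hsmall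
  refine ⟨R', h1, ?_⟩
  intro wc hwc hw Hc hHc ϖ hϖ0 hϖ u t r ht hr
  -- the bond energy datum
  have hF0 : ∀ e : ((Fin d → ZMod M) × (Fin d → Fin L)) × Fin d, 0 ≤
      ((R e *ᵥ fun b => u ((e.1.1 + ((((e.1.2 e.2 : ℕ) + 1) / L) • (Pi.single e.2 (1 : ZMod M))),
          update e.1.2 e.2 ⟨((e.1.2 e.2 : ℕ) + 1) % L, Nat.mod_lt _ hL⟩), b)) - fun b => u (e.1, b)) ⬝ᵥ
        ((R e *ᵥ fun b => u ((e.1.1 + ((((e.1.2 e.2 : ℕ) + 1) / L) • (Pi.single e.2 (1 : ZMod M))),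
          update e.1.2 e.2 ⟨((e.1.2 e.2 : ℕ) + 1) % L, Nat.mod_lt _ hL⟩), b)) - fun b => u (e.1, b)) := fun e => dotProduct_self_nonneg' _
  have hF : ∀ (y : Fin d → ZMod M) (z : Fin d → Fin L) (μ : Fin d) (h : (z μ : ℕ) + 1 < L),
      ((R ((y, z), μ) *ᵥ fun b => u ((y, update z μ ⟨(z μ : ℕ) + 1, h⟩), b)) - fun b => u ((y, z), b)) ⬝ᵥ
        ((R ((y, z), μ) *ᵥ fun b => u ((y, update z μ ⟨(z μ : ℕ) + 1, h⟩), b)) - fun b => u ((y, z), b)) ≤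
      (fun e : ((Fin d → ZMod M) × (Fin d → Fin L)) × Fin d =>
        ((R e *ᵥ fun b => u ((e.1.1 + ((((e.1.2 e.2 : ℕ) + 1) / L) • (Pi.single e.2 (1 : ZMod M))),
            update e.1.2 e.2 ⟨((e.1.2 e.2 : ℕ) + 1) % L, Nat.mod_lt _ hL⟩), b)) - fun b => u (e.1, b)) ⬝ᵥ
          ((R e *ᵥ fun b => u ((e.1.1 + ((((e.1.2 e.2 : ℕ) + 1) / L) • (Pi.single e.2 (1 : ZMod M))),
            update e.1.2 e.2 ⟨((e.1.2 e.2 : ℕ) + 1) % L, Nat.mod_lt _ hL⟩), b)) - fun b => u (e.1, b))) ((y, z), μ) := by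
    intro y z μ h
    dsimp only
    rw [nxt_eq_update hL y z μ h]
  have hP := blockVar_comb_le hL hW hWstep hQ u hF0 hF
  have hΦ := combPoincare_budget_tgt (L := L) (M := M) hF0 (hHf u) hϖ hϖ0
  have hΦ' := combPoincare_budget_src (L := L) (M := M) hF0 (hHf u) hϖ hϖ0
  refine h2 wc hwc hw Hc hHc u
    (fun u' y => 4 * (d * ((L : ℝ) - 1)) ^ 2 * ∑ z' : Fin d → Fin L, ∑ μ : Fin d,
      (fun e : ((Fin d → ZMod M) × (Fin d → Fin L)) × Fin d =>
        ((R e *ᵥ fun b => u' ((e.1.1 + ((((e.1.2 e.2 : ℕ) + 1) / L) • (Pi.single e.2 (1 : ZMod M))),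
            update e.1.2 e.2 ⟨((e.1.2 e.2 : ℕ) + 1) % L, Nat.mod_lt _ hL⟩), b)) - fun b => u' (e.1, b)) ⬝ᵥ
          ((R e *ᵥ fun b => u' ((e.1.1 + ((((e.1.2 e.2 : ℕ) + 1) / L) • (Pi.single e.2 (1 : ZMod M))),
            update e.1.2 e.2 ⟨((e.1.2 e.2 : ℕ) + 1) % L, Nat.mod_lt _ hL⟩), b)) - fun b => u' (e.1, b))) ((y, z'), μ))
    ϖ ϖ ?_ ?_ ?_ t r ht hr
  · exact hP
  · exact hΦ
  · exact hΦ'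

end End

end Summit.QuantumFields.BalabanUV.Beta.GAN24.DerivativeRateTransferJensenMassFreePoincare

end
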